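import Literature.Analysis.FluidPDE.ElgindiRadialDerivativeOperator
import Literature.Analysis.FluidPDE.ElgindiEtaWeightedCoercivity
import HarnessLib

/-!
# `L²` coercivity of `𝓛_Γ^T` with one `z`-derivative ([Elgindi2021] Proposition 6.9)

Topic `Literature/Analysis/FluidPDE`. Proof file (everything proved, no definitions, no named
facts) on the proof path of the named fact
`Literature.Analysis.FluidPDE.Elgindi.ElgindiGhoulMasmoudi2021_stabilityCore`
(`ElgindiStabilityDecomposition.lean`). T. M. Elgindi, Ann. of Math. 194 (2021) =
arXiv:1904.04795 (`[Elgindi2021]`), §6.2 "`L²` coercivity for `𝓛_Γ^T` with one `z`-derivative",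
**Proposition 6.9** (p. 17 of the held text):

> "Under the assumptions of Corollary 6.8, we have
> `((D_z𝓛_Γ^T(f)), (D_zf)w²/sin(2θ)^η)_{L²} ≥ ¼|(D_zf)w/√(sin(2θ)^η)|²_{L²} − 10⁸E_θ¹`",
> `E_θ¹ := |(D_θf)w/√(sin(2θ)^γ)|²_{L²} + |fw/√(sin(2θ)^η)|²_{L²}`.

The printed proof expands `D_z𝓛_Γ^T(f) = Σ_{i=1}^7 I_i` (vendored as `Dz_opLΓT`,
`ElgindiRadialDerivativeOperator.lean`) and lists the bounds
`(I₁, D_zf·w²/sin^η) ≥ ½|D_zf·w/√sin^η|²`, `|I₂w/√sin^η| ≤ |fw/√cos^η|`,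
`|I₃w/√sin^η| ≤ (10/√(1−η))|fw|`, `|I₄w/√sin^η| ≤ (10/√(1−η))|z⁻¹L₁₂f|`,
`|I₅w/√sin^η| ≤ 3|D_θf·w/√cos^η|`, `|(I₆, D_zf·w²/sin^η)| ≤ 3(1−η)|D_zf·w/√cos^η|²` [squared],
`|I₇w/√sin^η| ≤ (100/√(1−η))|fw|`, "The result now follows using the Cauchy–Schwarz inequality."

This file proves these bounds (in squared Cauchy–Schwarz form, with explicit constants: `I₂² ≤ ¼XZ`,
`I₃² ≤ 1157·AZ`, `I₄² ≤ 4625·AZ`, `I₅² ≤ (9/16)·YZ`, `−I₆ ≥ −(3/100)Z` (by parts, the vendored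
`integral_transport_eta_ge` applied to `D_zf`), `I₇ = ℓ₀J₇` with `ℓ₀² ≤ 153A`, `J₇² ≤ 1309Z`; here
`Z = ∬(D_zf·w)²sin^{−η}`, `X = ∬(fw)²sin^{−η}`, `Y = ∬(D_θf·w)²sin^{−γ}`, `A = ∬(fw)² ≤ X`, and
`|z⁻¹L₁₂f|²_{L²_z} ≤ (9π/8)A` is the vendored Hardy step) and assembles Proposition 6.9 with the
printed constants `¼` and `10⁸`, for `0 < α ≤ 1/200` and `f ∈ C³` compactly supported inside the
open strip with `L₁₂(f)(0) = 0` (so that `D_zf ∈ C²` and every pairing is a Lebesgue integral).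
-/

noncomputable section

open MeasureTheory Set Function Real Filter
open _root_.Topology

namespace Literature.Analysis.FluidPDE

namespace Elgindi

/-! ### Two elementary inequalities -/

/-- From `T² ≤ K·M·Z` (`K, M, Z ≥ 0`) and `δ > 0`: `|T| ≤ δZ + (K/(4δ))M` (the weighted Young step
behind "the result now follows using the Cauchy–Schwarz inequality"). [folklore] -/
theorem abs_le_of_sq_le_mul {T K M Z δ : ℝ} (hK : 0 ≤ K) (hM : 0 ≤ M) (hZ : 0 ≤ Z) (hδ : 0 < δ)
    (h : T ^ 2 ≤ K * M * Z) : |T| ≤ δ * Z + K / (4 * δ) * M := by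
  have hδ0 : δ ≠ 0 := hδ.ne'
  have hB : 0 ≤ δ * Z + K / (4 * δ) * M := by positivity
  have e : (δ * Z + K / (4 * δ) * M) ^ 2 = K * M * Z + (δ * Z - K / (4 * δ) * M) ^ 2 := by
    field_simp
    ring
  have key : T ^ 2 ≤ (δ * Z + K / (4 * δ) * M) ^ 2 := by
    rw [e]
    nlinarith [sq_nonneg (δ * Z - K / (4 * δ) * M)]
  exact abs_le_of_sq_le_sq key hB

/-- `∬(fw)² ≤ ∬(fw)²sin(2θ)^{−η}` (`sin(2θ)^{−η} ≥ 1` on the strip), `f ∈ C²` compactly supported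
inside the open strip. [folklore] -/
theorem integral_sq_le_weighted_eta {f : ℝ → ℝ → ℝ} (hf : ContDiff ℝ 2 (uncurry f))
    (hs : HasCompactSupport (uncurry f)) (hsub : tsupport (uncurry f) ⊆ strip) :
    ∫ p in strip, (f p.1 p.2 * radialWeight p.1) ^ 2 ≤
      ∫ p in strip, (f p.1 p.2 * radialWeight p.1) ^ 2 * Real.sin (2 * p.2) ^ (-eta) := by
  have i1 := integrableOn_sq_mul_radialWeight (hf.of_le (by norm_num)) hs hsub
    (F := fun p => f p.1 p.2) hf.continuous.continuousOn fun p hp =>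
      (image_eq_zero_of_notMem_tsupport hp : uncurry f p = 0)
  have i2 := integrableOn_mul_f_weight_eta hf hs hsub (c := fun p : ℝ × ℝ => f p.1 p.2)
    hf.continuous.continuousOn
  have e2 : ∫ p in strip, (f p.1 p.2 * radialWeight p.1) ^ 2 * Real.sin (2 * p.2) ^ (-eta) =
      ∫ p in strip, f p.1 p.2 * f p.1 p.2 * radialWeight p.1 ^ 2 * Real.sin (2 * p.2) ^ (-eta) :=
    setIntegral_congr_fun measurableSet_strip fun p _ => by ring
  rw [e2]
  refine setIntegral_mono_on i1 i2 measurableSet_strip fun p hp => ?_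
  have hsθ : 0 < Real.sin (2 * p.2) := Real.sin_pos_of_pos_of_lt_pi (by linarith [hp.2.1]) (by linarith [hp.2.2])
  have hρ1 : 1 ≤ Real.sin (2 * p.2) ^ (-eta) :=
    Real.one_le_rpow_of_pos_of_le_one_of_nonpos hsθ (Real.sin_le_one _) (by unfold eta; norm_num)
  calc (f p.1 p.2 * radialWeight p.1) ^ 2 = (f p.1 p.2 * radialWeight p.1) ^ 2 * 1 := by ring
    _ ≤ (f p.1 p.2 * radialWeight p.1) ^ 2 * Real.sin (2 * p.2) ^ (-eta) :=
        mul_le_mul_of_nonneg_left hρ1 (sq_nonneg _)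
    _ = f p.1 p.2 * f p.1 p.2 * radialWeight p.1 ^ 2 * Real.sin (2 * p.2) ^ (-eta) := by ring

section Prop69

variable {α : ℝ} {f : ℝ → ℝ → ℝ} (hf : ContDiff ℝ 3 (uncurry f)) (hs : HasCompactSupport (uncurry f))
  (hsub : tsupport (uncurry f) ⊆ strip)

include hf hs hsub

/-- **`I₂`**: `(∬(2z/(1+z)²)f·D_zf·w²sin^{−η})² ≤ ¼·∬(fw)²sin^{−η}·∬(D_zf·w)²sin^{−η}`
(`2z/(1+z)² ≤ ½`; printed: "`|I₂w/√sin^η| ≤ |fw/√cos^η|`"). [cite: Elgindi2021, §6.2, proof of Proposition 6.9 (p. 17 of arXiv:1904.04795)] -/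
theorem sq_I2_le :
    (∫ p in strip, 2 * p.1 / (1 + p.1) ^ 2 * f p.1 p.2 * Dz f p.1 p.2 * radialWeight p.1 ^ 2 *
        Real.sin (2 * p.2) ^ (-eta)) ^ 2 ≤
      1 / 4 * (∫ p in strip, (f p.1 p.2 * radialWeight p.1) ^ 2 * Real.sin (2 * p.2) ^ (-eta)) *
        ∫ p in strip, (Dz f p.1 p.2 * radialWeight p.1) ^ 2 * Real.sin (2 * p.2) ^ (-eta) := by
  have hf2 : ContDiff ℝ 2 (uncurry f) := hf.of_le (by norm_num)
  have hg : ContDiff ℝ 2 (uncurry (Dz f)) := contDiff_Dz (n := 2) hf hsub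
  have hgs : HasCompactSupport (uncurry (Dz f)) := hasCompactSupport_Dz hs
  have hgsub : tsupport (uncurry (Dz f)) ⊆ strip := tsupport_Dz_subset.trans hsub
  set τ : ℝ → ℝ := fun θ => Real.sin (2 * θ) ^ (-eta / 2) with hτ
  set φ : ℝ × ℝ → ℝ := fun p => 2 * p.1 / (1 + p.1) ^ 2 * f p.1 p.2 * radialWeight p.1 * τ p.2 with hφ
  set ψ : ℝ × ℝ → ℝ := fun p => Dz f p.1 p.2 * radialWeight p.1 * τ p.2 with hψ
  have hτ2 : ∀ p ∈ strip, τ p.2 ^ 2 = Real.sin (2 * p.2) ^ (-eta) := fun p hp =>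
    rpow_half_sq (Real.sin_pos_of_pos_of_lt_pi (by linarith [hp.2.1]) (by linarith [hp.2.2]))
  have eφψ : ∀ p ∈ strip, φ p * ψ p = 2 * p.1 / (1 + p.1) ^ 2 * f p.1 p.2 * Dz f p.1 p.2 *
      radialWeight p.1 ^ 2 * Real.sin (2 * p.2) ^ (-eta) := by
    intro p hp
    rw [← hτ2 p hp]
    simp only [hφ, hψ]
    ring
  have eφ2 : ∀ p ∈ strip, φ p ^ 2 = (2 * p.1 / (1 + p.1) ^ 2) ^ 2 * f p.1 p.2 * f p.1 p.2 *
      radialWeight p.1 ^ 2 * Real.sin (2 * p.2) ^ (-eta) := by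
    intro p hp
    rw [← hτ2 p hp]
    simp only [hφ]
    ring
  have eψ2 : ∀ p ∈ strip, ψ p ^ 2 = (Dz f p.1 p.2 * radialWeight p.1) ^ 2 * Real.sin (2 * p.2) ^ (-eta) := by
    intro p hp
    rw [← hτ2 p hp]
    simp only [hψ]
    ring
  have hq : ContinuousOn (fun p : ℝ × ℝ => 2 * p.1 / (1 + p.1) ^ 2) strip :=
    ContinuousOn.div (by fun_prop) (by fun_prop) fun p hp => by
      have : (0 : ℝ) < p.1 := hp.1; positivity
  have iφψ : IntegrableOn (fun p => φ p * ψ p) strip :=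
    (integrableOn_mul_f_weight_eta hg hgs hgsub (hq.mul hf.continuous.continuousOn)).congr_fun
      (fun p hp => (eφψ p hp).symm) measurableSet_strip
  have iφ2 : IntegrableOn (fun p => φ p ^ 2) strip :=
    (integrableOn_mul_f_weight_eta hf2 hs hsub ((hq.pow 2).mul hf.continuous.continuousOn)).congr_fun
      (fun p hp => (eφ2 p hp).symm) measurableSet_strip
  have iψ2 : IntegrableOn (fun p => ψ p ^ 2) strip := by
    have h := integrableOn_mul_f_weight_eta hg hgs hgsub (c := fun p : ℝ × ℝ => Dz f p.1 p.2)
      hg.continuous.continuousOn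
    refine h.congr_fun (fun p hp => ?_) measurableSet_strip
    rw [eψ2 p hp]; ring
  have iX := integrableOn_mul_f_weight_eta hf2 hs hsub (c := fun p : ℝ × ℝ => f p.1 p.2)
    hf2.continuous.continuousOn
  have hCS := sq_integral_mul_le iφ2 iψ2 iφψ
  set X : ℝ := ∫ p in strip, (f p.1 p.2 * radialWeight p.1) ^ 2 * Real.sin (2 * p.2) ^ (-eta) with hX
  set Z : ℝ := ∫ p in strip, (Dz f p.1 p.2 * radialWeight p.1) ^ 2 * Real.sin (2 * p.2) ^ (-eta) with hZ
  have hφ2le : ∫ p in strip, φ p ^ 2 ≤ 1 / 4 * X := by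
    have eX : X = ∫ p in strip, f p.1 p.2 * f p.1 p.2 * radialWeight p.1 ^ 2 * Real.sin (2 * p.2) ^ (-eta) :=
      setIntegral_congr_fun measurableSet_strip fun p _ => by ring
    rw [eX, ← integral_const_mul]
    refine setIntegral_mono_on iφ2 (iX.const_mul _) measurableSet_strip fun p hp => ?_
    rw [eφ2 p hp]
    have hz : (0 : ℝ) < p.1 := hp.1
    have hsθ : 0 < Real.sin (2 * p.2) := Real.sin_pos_of_pos_of_lt_pi (by linarith [hp.2.1]) (by linarith [hp.2.2])
    have hq1 : 2 * p.1 / (1 + p.1) ^ 2 ≤ 1 / 2 := by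
      rw [div_le_iff₀ (by positivity)]
      nlinarith [sq_nonneg (1 - p.1)]
    have hq0 : 0 ≤ 2 * p.1 / (1 + p.1) ^ 2 := by positivity
    have hq2 : (2 * p.1 / (1 + p.1) ^ 2) ^ 2 ≤ 1 / 4 := by nlinarith
    have hrest : 0 ≤ f p.1 p.2 * f p.1 p.2 * radialWeight p.1 ^ 2 * Real.sin (2 * p.2) ^ (-eta) := by
      have e : f p.1 p.2 * f p.1 p.2 * radialWeight p.1 ^ 2 * Real.sin (2 * p.2) ^ (-eta) =
          (f p.1 p.2 * radialWeight p.1) ^ 2 * Real.sin (2 * p.2) ^ (-eta) := by ring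
      rw [e]
      exact mul_nonneg (sq_nonneg _) (Real.rpow_nonneg hsθ.le _)
    calc (2 * p.1 / (1 + p.1) ^ 2) ^ 2 * f p.1 p.2 * f p.1 p.2 * radialWeight p.1 ^ 2 * Real.sin (2 * p.2) ^ (-eta)
        = (2 * p.1 / (1 + p.1) ^ 2) ^ 2 * (f p.1 p.2 * f p.1 p.2 * radialWeight p.1 ^ 2 *
            Real.sin (2 * p.2) ^ (-eta)) := by ring
      _ ≤ 1 / 4 * (f p.1 p.2 * f p.1 p.2 * radialWeight p.1 ^ 2 * Real.sin (2 * p.2) ^ (-eta)) :=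
          mul_le_mul_of_nonneg_right hq2 hrest
  have hZ0 : 0 ≤ Z := by
    simp only [hZ]
    rw [← setIntegral_congr_fun measurableSet_strip eψ2]
    exact integral_nonneg fun p => sq_nonneg _
  have eT : ∫ p in strip, 2 * p.1 / (1 + p.1) ^ 2 * f p.1 p.2 * Dz f p.1 p.2 * radialWeight p.1 ^ 2 *
      Real.sin (2 * p.2) ^ (-eta) = ∫ p in strip, φ p * ψ p :=
    (setIntegral_congr_fun measurableSet_strip eφψ).symm
  have eZ : ∫ p in strip, ψ p ^ 2 = Z := setIntegral_congr_fun measurableSet_strip eψ2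
  rw [eT]
  rw [eZ] at hCS
  calc (∫ p in strip, φ p * ψ p) ^ 2 ≤ (∫ p in strip, φ p ^ 2) * Z := hCS
    _ ≤ (1 / 4 * X) * Z := mul_le_mul_of_nonneg_right hφ2le hZ0
    _ = 1 / 4 * X * Z := by ring

/-- **`I₃`**: with `I₃ = ∬(2zΓ/(c(1+z)²))(K,f)_θ·D_zf·w²sin^{−η}`, `I₃² ≤ 1157·∬(fw)²·∬(D_zf·w)²sin^{−η}`
(`∫(K,f)_θ²/z² ≤ (9π/32)∬(fw)²`, `∫Γ²sin^{−η} ≤ 100π`, `c ≥ 49/50`; printed: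
"`|I₃w/√sin^η| ≤ (10/√(1−η))|fw|`"). [cite: Elgindi2021, §6.2, proof of Proposition 6.9 (p. 17 of arXiv:1904.04795)] -/
theorem sq_I3_le (hα : 0 < α) (hα' : α ≤ 1 / 200) :
    (∫ p in strip, 2 * p.1 * angularWeight α p.2 / (profileConst α * (1 + p.1) ^ 2) * kMoment f p.1 *
        Dz f p.1 p.2 * radialWeight p.1 ^ 2 * Real.sin (2 * p.2) ^ (-eta)) ^ 2 ≤
      1157 * (∫ p in strip, (f p.1 p.2 * radialWeight p.1) ^ 2) *
        ∫ p in strip, (Dz f p.1 p.2 * radialWeight p.1) ^ 2 * Real.sin (2 * p.2) ^ (-eta) := by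
  have hf2 : ContDiff ℝ 2 (uncurry f) := hf.of_le (by norm_num)
  have hg : ContDiff ℝ 2 (uncurry (Dz f)) := contDiff_Dz (n := 2) hf hsub
  have hgs : HasCompactSupport (uncurry (Dz f)) := hasCompactSupport_Dz hs
  have hgsub : tsupport (uncurry (Dz f)) ⊆ strip := tsupport_Dz_subset.trans hsub
  have hcpos : 0 < profileConst α := profileConst_pos hα.le
  have hc49 : (49 / 50 : ℝ) ≤ profileConst α := profileConst_ge hα.le hα'
  have hfc : Continuous (uncurry f) := hf.continuous
  obtain ⟨a, b, ha, -, hfab⟩ := exists_radial_bounds' hs hsub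
  set L : ℝ → ℝ := kMoment f with hLdef
  have hLa : ∀ z, z < a → L z = 0 := fun z hz => kMoment_eq_zero_of_not_mem hfab (Or.inl hz)
  have hLb : ∀ z, b < z → L z = 0 := fun z hz => kMoment_eq_zero_of_not_mem hfab (Or.inr hz)
  have hLc : Continuous L := continuous_kMoment hfc
  have hΓc : Continuous (angularWeight α) := continuous_angularWeight hα.le
  set τ : ℝ → ℝ := fun θ => Real.sin (2 * θ) ^ (-eta / 2) with hτ
  set φ : ℝ × ℝ → ℝ := fun p => Dz f p.1 p.2 * radialWeight p.1 * τ p.2 with hφ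
  set ψ : ℝ × ℝ → ℝ := fun p => 2 / (profileConst α * p.1) * L p.1 * angularWeight α p.2 * τ p.2 with hψ
  have hτ2 : ∀ p ∈ strip, τ p.2 ^ 2 = Real.sin (2 * p.2) ^ (-eta) := fun p hp =>
    rpow_half_sq (Real.sin_pos_of_pos_of_lt_pi (by linarith [hp.2.1]) (by linarith [hp.2.2]))
  have eφψ : ∀ p ∈ strip, φ p * ψ p = 2 * p.1 * angularWeight α p.2 / (profileConst α * (1 + p.1) ^ 2) *
      kMoment f p.1 * Dz f p.1 p.2 * radialWeight p.1 ^ 2 * Real.sin (2 * p.2) ^ (-eta) := by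
    intro p hp
    have hz : (0 : ℝ) < p.1 := hp.1
    rw [← hτ2 p hp]
    simp only [hφ, hψ, hLdef]
    unfold radialWeight
    field_simp
  have eφ2 : ∀ p ∈ strip, φ p ^ 2 = (Dz f p.1 p.2 * radialWeight p.1) ^ 2 * Real.sin (2 * p.2) ^ (-eta) := by
    intro p hp
    rw [← hτ2 p hp]
    simp only [hφ]
    ring
  have eψ2 : ∀ p ∈ strip, ψ p ^ 2 = (4 / profileConst α ^ 2 * (1 / p.1 ^ 2 * L p.1 ^ 2)) *
      (angularWeight α p.2 ^ 2 * Real.sin (2 * p.2) ^ (-eta)) := by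
    intro p hp
    have hz : (0 : ℝ) < p.1 := hp.1
    rw [← hτ2 p hp]
    simp only [hψ]
    field_simp
    ring
  have iφψ : IntegrableOn (fun p => φ p * ψ p) strip := by
    have hc : ContinuousOn (fun p : ℝ × ℝ => 2 * p.1 * angularWeight α p.2 /
        (profileConst α * (1 + p.1) ^ 2) * kMoment f p.1) strip := by
      refine (ContinuousOn.div (by exact ((continuous_const.mul continuous_fst).mul
        (hΓc.comp continuous_snd)).continuousOn) (by fun_prop) fun p hp => ?_).mul
        (hLc.comp continuous_fst).continuousOn
      have : (0 : ℝ) < p.1 := hp.1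
      exact mul_ne_zero hcpos.ne' (by positivity)
    exact (integrableOn_mul_f_weight_eta hg hgs hgsub hc).congr_fun (fun p hp => (eφψ p hp).symm)
      measurableSet_strip
  have iφ2 : IntegrableOn (fun p => φ p ^ 2) strip := by
    have h := integrableOn_mul_f_weight_eta hg hgs hgsub (c := fun p : ℝ × ℝ => Dz f p.1 p.2)
      hg.continuous.continuousOn
    refine h.congr_fun (fun p hp => ?_) measurableSet_strip
    rw [eφ2 p hp]; ring
  have iz : Integrable (fun z : ℝ => 4 / profileConst α ^ 2 * (1 / z ^ 2 * L z ^ 2)) (volume.restrict (Ioi 0)) := by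
    have hu2 : ContinuousOn (fun z : ℝ => 1 / z ^ 2) {0}ᶜ :=
      ContinuousOn.div continuousOn_const (continuousOn_id.pow 2) fun z hz => pow_ne_zero 2 hz
    have hLs : HasCompactSupport L := by
      refine HasCompactSupport.intro (isCompact_Icc (a := a) (b := b)) fun z hz => ?_
      rcases not_and_or.1 (fun h => hz ⟨h.1, h.2⟩ : ¬(a ≤ z ∧ z ≤ b)) with h | h
      · exact hLa z (not_le.1 h)
      · exact hLb z (not_le.1 h)
    have h : Integrable (fun z : ℝ => 1 / z ^ 2 * L z ^ 2) :=
      (continuous_mul_of_eq_zero_lt hu2 (hLc.pow 2) ha fun z hz => by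
        simp [hLa z hz]).integrable_of_hasCompactSupport
        (HasCompactSupport.intro hLs fun z hz => by simp [image_eq_zero_of_notMem_tsupport hz])
    exact (h.const_mul _).integrableOn
  have iθ : Integrable (fun θ : ℝ => angularWeight α θ ^ 2 * Real.sin (2 * θ) ^ (-eta))
      (volume.restrict (Ioo 0 (π / 2))) := integrableOn_angularWeight_sq_mul_rpow_eta hα.le
  have iψ2 : IntegrableOn (fun p => ψ p ^ 2) strip := by
    have h := iz.mul_prod iθ
    rw [← volume_restrict_strip] at h
    exact IntegrableOn.congr_fun h (fun p hp => (eψ2 p hp).symm) measurableSet_strip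
  have hCS := sq_integral_mul_le iφ2 iψ2 iφψ
  have hψ2 : ∫ p in strip, ψ p ^ 2 = (4 / profileConst α ^ 2 * ∫ z in Ioi 0, 1 / z ^ 2 * L z ^ 2) *
      ∫ θ in Ioo 0 (π / 2), angularWeight α θ ^ 2 * Real.sin (2 * θ) ^ (-eta) := by
    rw [setIntegral_congr_fun measurableSet_strip eψ2, volume_restrict_strip,
      integral_prod_mul (f := fun z : ℝ => 4 / profileConst α ^ 2 * (1 / z ^ 2 * L z ^ 2))
        (g := fun θ : ℝ => angularWeight α θ ^ 2 * Real.sin (2 * θ) ^ (-eta)), integral_const_mul]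
  have hLz : ∫ z in Ioi 0, 1 / z ^ 2 * L z ^ 2 = ∫ z, 1 / z ^ 2 * L z ^ 2 := by
    refine setIntegral_eq_integral_of_forall_compl_eq_zero fun z hz => ?_
    rw [hLa z (lt_of_le_of_lt (not_lt.1 hz) ha)]; ring
  have hHardy := integral_sq_kMoment_div_sq_le hf2 hs hsub
  have hAng := integral_angularWeight_sq_mul_rpow_eta_le hα.le
  set A : ℝ := ∫ p in strip, (f p.1 p.2 * radialWeight p.1) ^ 2 with hA
  set Z : ℝ := ∫ p in strip, (Dz f p.1 p.2 * radialWeight p.1) ^ 2 * Real.sin (2 * p.2) ^ (-eta) with hZ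
  have hA0 : 0 ≤ A := integral_nonneg fun p => sq_nonneg _
  have hZ0 : 0 ≤ Z := by
    simp only [hZ]
    rw [← setIntegral_congr_fun measurableSet_strip eφ2]
    exact integral_nonneg fun p => sq_nonneg _
  have hLz0 : 0 ≤ ∫ z, 1 / z ^ 2 * L z ^ 2 := integral_nonneg fun z => by positivity
  have hAng0 : 0 ≤ ∫ θ in Ioo 0 (π / 2), angularWeight α θ ^ 2 * Real.sin (2 * θ) ^ (-eta) := by
    refine setIntegral_nonneg measurableSet_Ioo fun θ hθ => ?_
    have hsθ : 0 < Real.sin (2 * θ) := Real.sin_pos_of_pos_of_lt_pi (by linarith [hθ.1]) (by linarith [hθ.2])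
    exact mul_nonneg (sq_nonneg _) (Real.rpow_nonneg hsθ.le _)
  have eT : ∫ p in strip, 2 * p.1 * angularWeight α p.2 / (profileConst α * (1 + p.1) ^ 2) * kMoment f p.1 *
      Dz f p.1 p.2 * radialWeight p.1 ^ 2 * Real.sin (2 * p.2) ^ (-eta) = ∫ p in strip, φ p * ψ p :=
    (setIntegral_congr_fun measurableSet_strip eφψ).symm
  have eZ : ∫ p in strip, φ p ^ 2 = Z := setIntegral_congr_fun measurableSet_strip eφ2
  rw [eT]
  rw [eZ, hψ2, hLz] at hCS
  have hc2 : 4 / profileConst α ^ 2 ≤ 4 / (49 / 50 : ℝ) ^ 2 := by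
    apply div_le_div_of_nonneg_left (by norm_num) (by norm_num)
    exact pow_le_pow_left₀ (by norm_num) hc49 2
  have hπ := Real.pi_lt_d4
  have hψ2le : (4 / profileConst α ^ 2 * ∫ z, 1 / z ^ 2 * L z ^ 2) *
      ∫ θ in Ioo 0 (π / 2), angularWeight α θ ^ 2 * Real.sin (2 * θ) ^ (-eta) ≤ 1157 * A := by
    have h1 : 4 / profileConst α ^ 2 * ∫ z, 1 / z ^ 2 * L z ^ 2 ≤ 4 / (49 / 50 : ℝ) ^ 2 * (9 * π / 32 * A) :=
      mul_le_mul hc2 hHardy hLz0 (by norm_num)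
    have hππA : π * (π * A) ≤ 3.1416 * (3.1416 * A) :=
      mul_le_mul hπ.le (mul_le_mul_of_nonneg_right hπ.le hA0) (by positivity) (by norm_num)
    calc (4 / profileConst α ^ 2 * ∫ z, 1 / z ^ 2 * L z ^ 2) *
          ∫ θ in Ioo 0 (π / 2), angularWeight α θ ^ 2 * Real.sin (2 * θ) ^ (-eta)
        ≤ (4 / (49 / 50 : ℝ) ^ 2 * (9 * π / 32 * A)) * (100 * π) := mul_le_mul h1 hAng hAng0 (by positivity)
      _ ≤ 1157 * A := by nlinarith [hππA, hA0]
  calc (∫ p in strip, φ p * ψ p) ^ 2 ≤ Z * ((4 / profileConst α ^ 2 * ∫ z, 1 / z ^ 2 * L z ^ 2) *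
        ∫ θ in Ioo 0 (π / 2), angularWeight α θ ^ 2 * Real.sin (2 * θ) ^ (-eta)) := hCS
    _ ≤ Z * (1157 * A) := mul_le_mul_of_nonneg_left hψ2le hZ0
    _ = 1157 * A * Z := by ring

/-- **`I₄`**: with `I₄ = ∬(2z(1−z)Γ/(c(1+z)³))L₁₂(f)·D_zf·w²sin^{−η}`,
`I₄² ≤ 4625·∬(fw)²·∬(D_zf·w)²sin^{−η}` (`|1−z| ≤ 1+z`, Hardy `∫L₁₂(f)²/z² ≤ (9π/8)∬(fw)²`,
`∫Γ²sin^{−η} ≤ 100π`; printed: "`|I₄w/√sin^η| ≤ (10/√(1−η))|z⁻¹L₁₂(f)|_{L²_z}`"). [cite: Elgindi2021, §6.2, proof of Proposition 6.9 (p. 17 of arXiv:1904.04795)] -/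
theorem sq_I4_le (hα : 0 < α) (hα' : α ≤ 1 / 200) (hL0 : L12 f 0 = 0) :
    (∫ p in strip, 2 * p.1 * (1 - p.1) * angularWeight α p.2 / (profileConst α * (1 + p.1) ^ 3) *
        L12 f p.1 * Dz f p.1 p.2 * radialWeight p.1 ^ 2 * Real.sin (2 * p.2) ^ (-eta)) ^ 2 ≤
      4625 * (∫ p in strip, (f p.1 p.2 * radialWeight p.1) ^ 2) *
        ∫ p in strip, (Dz f p.1 p.2 * radialWeight p.1) ^ 2 * Real.sin (2 * p.2) ^ (-eta) := by
  have hf2 : ContDiff ℝ 2 (uncurry f) := hf.of_le (by norm_num)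
  have hg : ContDiff ℝ 2 (uncurry (Dz f)) := contDiff_Dz (n := 2) hf hsub
  have hgs : HasCompactSupport (uncurry (Dz f)) := hasCompactSupport_Dz hs
  have hgsub : tsupport (uncurry (Dz f)) ⊆ strip := tsupport_Dz_subset.trans hsub
  have hcpos : 0 < profileConst α := profileConst_pos hα.le
  have hc49 : (49 / 50 : ℝ) ≤ profileConst α := profileConst_ge hα.le hα'
  have hfc : Continuous (uncurry f) := hf.continuous
  obtain ⟨a, b, ha, -, hfab⟩ := exists_radial_bounds' hs hsub
  set L : ℝ → ℝ := L12 f with hLdef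
  have hLa : ∀ z, z < a → L z = 0 := fun z hz => (L12_eq_L12_zero_of_le hfc ha hfab hz.le).trans hL0
  have hLb : ∀ z, b < z → L z = 0 := fun z hz => L12_eq_zero_of_le hfc ha hfab hz.le
  have hLc : Continuous L := continuous_L12 hfc hs hsub
  have hΓc : Continuous (angularWeight α) := continuous_angularWeight hα.le
  set τ : ℝ → ℝ := fun θ => Real.sin (2 * θ) ^ (-eta / 2) with hτ
  set φ : ℝ × ℝ → ℝ := fun p => (1 - p.1) / (1 + p.1) * Dz f p.1 p.2 * radialWeight p.1 * τ p.2 with hφ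
  set ψ : ℝ × ℝ → ℝ := fun p => 2 / (profileConst α * p.1) * L p.1 * angularWeight α p.2 * τ p.2 with hψ
  have hτ2 : ∀ p ∈ strip, τ p.2 ^ 2 = Real.sin (2 * p.2) ^ (-eta) := fun p hp =>
    rpow_half_sq (Real.sin_pos_of_pos_of_lt_pi (by linarith [hp.2.1]) (by linarith [hp.2.2]))
  have eφψ : ∀ p ∈ strip, φ p * ψ p = 2 * p.1 * (1 - p.1) * angularWeight α p.2 /
      (profileConst α * (1 + p.1) ^ 3) * L12 f p.1 * Dz f p.1 p.2 * radialWeight p.1 ^ 2 *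
      Real.sin (2 * p.2) ^ (-eta) := by
    intro p hp
    have hz : (0 : ℝ) < p.1 := hp.1
    rw [← hτ2 p hp]
    simp only [hφ, hψ, hLdef]
    unfold radialWeight
    field_simp
  have eφ2 : ∀ p ∈ strip, φ p ^ 2 = ((1 - p.1) / (1 + p.1)) ^ 2 * Dz f p.1 p.2 * Dz f p.1 p.2 *
      radialWeight p.1 ^ 2 * Real.sin (2 * p.2) ^ (-eta) := by
    intro p hp
    rw [← hτ2 p hp]
    simp only [hφ]
    ring
  have eψ2 : ∀ p ∈ strip, ψ p ^ 2 = (4 / profileConst α ^ 2 * (1 / p.1 ^ 2 * L p.1 ^ 2)) *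
      (angularWeight α p.2 ^ 2 * Real.sin (2 * p.2) ^ (-eta)) := by
    intro p hp
    have hz : (0 : ℝ) < p.1 := hp.1
    rw [← hτ2 p hp]
    simp only [hψ]
    field_simp
    ring
  have hq : ContinuousOn (fun p : ℝ × ℝ => (1 - p.1) / (1 + p.1)) strip :=
    ContinuousOn.div (by fun_prop) (by fun_prop) fun p hp => by
      have : (0 : ℝ) < p.1 := hp.1; positivity
  have iφψ : IntegrableOn (fun p => φ p * ψ p) strip := by
    have hc : ContinuousOn (fun p : ℝ × ℝ => 2 * p.1 * (1 - p.1) * angularWeight α p.2 /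
        (profileConst α * (1 + p.1) ^ 3) * L12 f p.1) strip := by
      refine (ContinuousOn.div (by exact (((continuous_const.mul continuous_fst).mul
        (continuous_const.sub continuous_fst)).mul (hΓc.comp continuous_snd)).continuousOn)
        (by fun_prop) fun p hp => ?_).mul (hLc.comp continuous_fst).continuousOn
      have : (0 : ℝ) < p.1 := hp.1
      exact mul_ne_zero hcpos.ne' (by positivity)
    exact (integrableOn_mul_f_weight_eta hg hgs hgsub hc).congr_fun (fun p hp => (eφψ p hp).symm)
      measurableSet_strip
  have iφ2 : IntegrableOn (fun p => φ p ^ 2) strip :=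
    (integrableOn_mul_f_weight_eta hg hgs hgsub ((hq.pow 2).mul hg.continuous.continuousOn)).congr_fun
      (fun p hp => (eφ2 p hp).symm) measurableSet_strip
  have iZ : IntegrableOn (fun p : ℝ × ℝ => Dz f p.1 p.2 * Dz f p.1 p.2 * radialWeight p.1 ^ 2 *
      Real.sin (2 * p.2) ^ (-eta)) strip :=
    integrableOn_mul_f_weight_eta hg hgs hgsub (c := fun p : ℝ × ℝ => Dz f p.1 p.2) hg.continuous.continuousOn
  have iz : Integrable (fun z : ℝ => 4 / profileConst α ^ 2 * (1 / z ^ 2 * L z ^ 2)) (volume.restrict (Ioi 0)) := by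
    have hu2 : ContinuousOn (fun z : ℝ => 1 / z ^ 2) {0}ᶜ :=
      ContinuousOn.div continuousOn_const (continuousOn_id.pow 2) fun z hz => pow_ne_zero 2 hz
    have hLs : HasCompactSupport L := by
      refine HasCompactSupport.intro (isCompact_Icc (a := a) (b := b)) fun z hz => ?_
      rcases not_and_or.1 (fun h => hz ⟨h.1, h.2⟩ : ¬(a ≤ z ∧ z ≤ b)) with h | h
      · exact hLa z (not_le.1 h)
      · exact hLb z (not_le.1 h)
    have h : Integrable (fun z : ℝ => 1 / z ^ 2 * L z ^ 2) :=
      (continuous_mul_of_eq_zero_lt hu2 (hLc.pow 2) ha fun z hz => by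
        simp [hLa z hz]).integrable_of_hasCompactSupport
        (HasCompactSupport.intro hLs fun z hz => by simp [image_eq_zero_of_notMem_tsupport hz])
    exact (h.const_mul _).integrableOn
  have iθ : Integrable (fun θ : ℝ => angularWeight α θ ^ 2 * Real.sin (2 * θ) ^ (-eta))
      (volume.restrict (Ioo 0 (π / 2))) := integrableOn_angularWeight_sq_mul_rpow_eta hα.le
  have iψ2 : IntegrableOn (fun p => ψ p ^ 2) strip := by
    have h := iz.mul_prod iθ
    rw [← volume_restrict_strip] at h
    exact IntegrableOn.congr_fun h (fun p hp => (eψ2 p hp).symm) measurableSet_strip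
  have hCS := sq_integral_mul_le iφ2 iψ2 iφψ
  have hψ2 : ∫ p in strip, ψ p ^ 2 = (4 / profileConst α ^ 2 * ∫ z in Ioi 0, 1 / z ^ 2 * L z ^ 2) *
      ∫ θ in Ioo 0 (π / 2), angularWeight α θ ^ 2 * Real.sin (2 * θ) ^ (-eta) := by
    rw [setIntegral_congr_fun measurableSet_strip eψ2, volume_restrict_strip,
      integral_prod_mul (f := fun z : ℝ => 4 / profileConst α ^ 2 * (1 / z ^ 2 * L z ^ 2))
        (g := fun θ : ℝ => angularWeight α θ ^ 2 * Real.sin (2 * θ) ^ (-eta)), integral_const_mul]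
  have hLz : ∫ z in Ioi 0, 1 / z ^ 2 * L z ^ 2 = ∫ z, 1 / z ^ 2 * L z ^ 2 := by
    refine setIntegral_eq_integral_of_forall_compl_eq_zero fun z hz => ?_
    rw [hLa z (lt_of_le_of_lt (not_lt.1 hz) ha)]; ring
  have hHardy := integral_sq_L12_div_sq_le hf2 hs hsub hL0
  have hAng := integral_angularWeight_sq_mul_rpow_eta_le hα.le
  set A : ℝ := ∫ p in strip, (f p.1 p.2 * radialWeight p.1) ^ 2 with hA
  set Z : ℝ := ∫ p in strip, (Dz f p.1 p.2 * radialWeight p.1) ^ 2 * Real.sin (2 * p.2) ^ (-eta) with hZ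
  have eZ : Z = ∫ p in strip, Dz f p.1 p.2 * Dz f p.1 p.2 * radialWeight p.1 ^ 2 * Real.sin (2 * p.2) ^ (-eta) :=
    setIntegral_congr_fun measurableSet_strip fun p _ => by ring
  have hφ2le : ∫ p in strip, φ p ^ 2 ≤ Z := by
    rw [eZ]
    refine setIntegral_mono_on iφ2 iZ measurableSet_strip fun p hp => ?_
    rw [eφ2 p hp]
    have hz : (0 : ℝ) < p.1 := hp.1
    have hsθ : 0 < Real.sin (2 * p.2) := Real.sin_pos_of_pos_of_lt_pi (by linarith [hp.2.1]) (by linarith [hp.2.2])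
    have hq2 : ((1 - p.1) / (1 + p.1)) ^ 2 ≤ 1 := by
      rw [div_pow, div_le_one (by positivity)]
      nlinarith
    have hrest : 0 ≤ Dz f p.1 p.2 * Dz f p.1 p.2 * radialWeight p.1 ^ 2 * Real.sin (2 * p.2) ^ (-eta) := by
      have e : Dz f p.1 p.2 * Dz f p.1 p.2 * radialWeight p.1 ^ 2 * Real.sin (2 * p.2) ^ (-eta) =
          (Dz f p.1 p.2 * radialWeight p.1) ^ 2 * Real.sin (2 * p.2) ^ (-eta) := by ring
      rw [e]
      exact mul_nonneg (sq_nonneg _) (Real.rpow_nonneg hsθ.le _)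
    calc ((1 - p.1) / (1 + p.1)) ^ 2 * Dz f p.1 p.2 * Dz f p.1 p.2 * radialWeight p.1 ^ 2 *
          Real.sin (2 * p.2) ^ (-eta)
        = ((1 - p.1) / (1 + p.1)) ^ 2 * (Dz f p.1 p.2 * Dz f p.1 p.2 * radialWeight p.1 ^ 2 *
            Real.sin (2 * p.2) ^ (-eta)) := by ring
      _ ≤ 1 * (Dz f p.1 p.2 * Dz f p.1 p.2 * radialWeight p.1 ^ 2 * Real.sin (2 * p.2) ^ (-eta)) :=
          mul_le_mul_of_nonneg_right hq2 hrest
      _ = _ := one_mul _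
  have hA0 : 0 ≤ A := integral_nonneg fun p => sq_nonneg _
  have hZ0 : 0 ≤ Z := by
    simp only [hZ]
    exact setIntegral_nonneg measurableSet_strip fun p hp => mul_nonneg (sq_nonneg _)
      (Real.rpow_nonneg (Real.sin_pos_of_pos_of_lt_pi (by linarith [hp.2.1]) (by linarith [hp.2.2])).le _)
  have hφ20 : 0 ≤ ∫ p in strip, φ p ^ 2 := integral_nonneg fun p => sq_nonneg _
  have hLz0 : 0 ≤ ∫ z, 1 / z ^ 2 * L z ^ 2 := integral_nonneg fun z => by positivity
  have hAng0 : 0 ≤ ∫ θ in Ioo 0 (π / 2), angularWeight α θ ^ 2 * Real.sin (2 * θ) ^ (-eta) := by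
    refine setIntegral_nonneg measurableSet_Ioo fun θ hθ => ?_
    have hsθ : 0 < Real.sin (2 * θ) := Real.sin_pos_of_pos_of_lt_pi (by linarith [hθ.1]) (by linarith [hθ.2])
    exact mul_nonneg (sq_nonneg _) (Real.rpow_nonneg hsθ.le _)
  have eT : ∫ p in strip, 2 * p.1 * (1 - p.1) * angularWeight α p.2 / (profileConst α * (1 + p.1) ^ 3) *
      L12 f p.1 * Dz f p.1 p.2 * radialWeight p.1 ^ 2 * Real.sin (2 * p.2) ^ (-eta) =
      ∫ p in strip, φ p * ψ p :=
    (setIntegral_congr_fun measurableSet_strip eφψ).symm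
  rw [eT]
  rw [hψ2, hLz] at hCS
  have hc2 : 4 / profileConst α ^ 2 ≤ 4 / (49 / 50 : ℝ) ^ 2 := by
    apply div_le_div_of_nonneg_left (by norm_num) (by norm_num)
    exact pow_le_pow_left₀ (by norm_num) hc49 2
  have hπ := Real.pi_lt_d4
  have hψ2le : (4 / profileConst α ^ 2 * ∫ z, 1 / z ^ 2 * L z ^ 2) *
      ∫ θ in Ioo 0 (π / 2), angularWeight α θ ^ 2 * Real.sin (2 * θ) ^ (-eta) ≤ 4625 * A := by
    have h1 : 4 / profileConst α ^ 2 * ∫ z, 1 / z ^ 2 * L z ^ 2 ≤ 4 / (49 / 50 : ℝ) ^ 2 * (9 * π / 8 * A) :=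
      mul_le_mul hc2 hHardy hLz0 (by norm_num)
    have hππA : π * (π * A) ≤ 3.1416 * (3.1416 * A) :=
      mul_le_mul hπ.le (mul_le_mul_of_nonneg_right hπ.le hA0) (by positivity) (by norm_num)
    calc (4 / profileConst α ^ 2 * ∫ z, 1 / z ^ 2 * L z ^ 2) *
          ∫ θ in Ioo 0 (π / 2), angularWeight α θ ^ 2 * Real.sin (2 * θ) ^ (-eta)
        ≤ (4 / (49 / 50 : ℝ) ^ 2 * (9 * π / 8 * A)) * (100 * π) := mul_le_mul h1 hAng hAng0 (by positivity)
      _ ≤ 4625 * A := by nlinarith [hππA, hA0]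
  have hψ20 : 0 ≤ (4 / profileConst α ^ 2 * ∫ z, 1 / z ^ 2 * L z ^ 2) *
      ∫ θ in Ioo 0 (π / 2), angularWeight α θ ^ 2 * Real.sin (2 * θ) ^ (-eta) := by positivity
  calc (∫ p in strip, φ p * ψ p) ^ 2 ≤ (∫ p in strip, φ p ^ 2) * ((4 / profileConst α ^ 2 *
        ∫ z, 1 / z ^ 2 * L z ^ 2) * ∫ θ in Ioo 0 (π / 2), angularWeight α θ ^ 2 * Real.sin (2 * θ) ^ (-eta)) := hCS
    _ ≤ Z * (4625 * A) := mul_le_mul hφ2le hψ2le hψ20 hZ0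
    _ = 4625 * A * Z := by ring

/-- **`I₅`**: `(∬(3z/(1+z)²)D_θf·D_zf·w²sin^{−η})² ≤ (9/16)·∬(D_θf·w)²sin^{−γ}·∬(D_zf·w)²sin^{−η}`
(`3z/(1+z)² ≤ ¾`, `sin^{−η} ≤ sin^{−γ}` as `γ = 1 + α/10 ≥ η`; printed:
"`|I₅w/√sin^η| ≤ 3|D_θf·w/√cos^η|`"). [cite: Elgindi2021, §6.2, proof of Proposition 6.9 (p. 17 of arXiv:1904.04795)] -/
theorem sq_I5_le (hα : 0 ≤ α) :
    (∫ p in strip, 3 * p.1 / (1 + p.1) ^ 2 * Dθ f p.1 p.2 * Dz f p.1 p.2 * radialWeight p.1 ^ 2 *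
        Real.sin (2 * p.2) ^ (-eta)) ^ 2 ≤
      9 / 16 * (∫ p in strip, (Dθ f p.1 p.2 * radialWeight p.1) ^ 2 * Real.sin (2 * p.2) ^ (-gammaExp α)) *
        ∫ p in strip, (Dz f p.1 p.2 * radialWeight p.1) ^ 2 * Real.sin (2 * p.2) ^ (-eta) := by
  have hf2 : ContDiff ℝ 2 (uncurry f) := hf.of_le (by norm_num)
  have hf1 : ContDiff ℝ 1 (uncurry f) := hf.of_le (by norm_num)
  have hg : ContDiff ℝ 2 (uncurry (Dz f)) := contDiff_Dz (n := 2) hf hsub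
  have hgs : HasCompactSupport (uncurry (Dz f)) := hasCompactSupport_Dz hs
  have hgsub : tsupport (uncurry (Dz f)) ⊆ strip := tsupport_Dz_subset.trans hsub
  have hD : ContDiff ℝ 2 (uncurry (Dθ f)) := contDiff_Dθ (n := 2) hf hsub
  have hDs : HasCompactSupport (uncurry (Dθ f)) := hasCompactSupport_Dθ hs
  have hDsub : tsupport (uncurry (Dθ f)) ⊆ strip := tsupport_Dθ_subset.trans hsub
  have hDon : ContinuousOn (fun p : ℝ × ℝ => Dθ f p.1 p.2) strip := (continuous_Dθ hf1).continuousOn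
  set τ : ℝ → ℝ := fun θ => Real.sin (2 * θ) ^ (-eta / 2) with hτ
  set φ : ℝ × ℝ → ℝ := fun p => 3 * p.1 / (1 + p.1) ^ 2 * Dθ f p.1 p.2 * radialWeight p.1 * τ p.2 with hφ
  set ψ : ℝ × ℝ → ℝ := fun p => Dz f p.1 p.2 * radialWeight p.1 * τ p.2 with hψ
  have hτ2 : ∀ p ∈ strip, τ p.2 ^ 2 = Real.sin (2 * p.2) ^ (-eta) := fun p hp =>
    rpow_half_sq (Real.sin_pos_of_pos_of_lt_pi (by linarith [hp.2.1]) (by linarith [hp.2.2]))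
  have eφψ : ∀ p ∈ strip, φ p * ψ p = 3 * p.1 / (1 + p.1) ^ 2 * Dθ f p.1 p.2 * Dz f p.1 p.2 *
      radialWeight p.1 ^ 2 * Real.sin (2 * p.2) ^ (-eta) := by
    intro p hp
    rw [← hτ2 p hp]
    simp only [hφ, hψ]
    ring
  have eφ2 : ∀ p ∈ strip, φ p ^ 2 = (3 * p.1 / (1 + p.1) ^ 2) ^ 2 * Dθ f p.1 p.2 * Dθ f p.1 p.2 *
      radialWeight p.1 ^ 2 * Real.sin (2 * p.2) ^ (-eta) := by
    intro p hp
    rw [← hτ2 p hp]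
    simp only [hφ]
    ring
  have eψ2 : ∀ p ∈ strip, ψ p ^ 2 = (Dz f p.1 p.2 * radialWeight p.1) ^ 2 * Real.sin (2 * p.2) ^ (-eta) := by
    intro p hp
    rw [← hτ2 p hp]
    simp only [hψ]
    ring
  have hq : ContinuousOn (fun p : ℝ × ℝ => 3 * p.1 / (1 + p.1) ^ 2) strip :=
    ContinuousOn.div (by fun_prop) (by fun_prop) fun p hp => by
      have : (0 : ℝ) < p.1 := hp.1; positivity
  have iφψ : IntegrableOn (fun p => φ p * ψ p) strip :=
    (integrableOn_mul_f_weight_eta hg hgs hgsub (hq.mul hDon)).congr_fun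
      (fun p hp => (eφψ p hp).symm) measurableSet_strip
  have iφ2 : IntegrableOn (fun p => φ p ^ 2) strip :=
    (integrableOn_mul_f_weight_eta hD hDs hDsub ((hq.pow 2).mul hDon)).congr_fun
      (fun p hp => (eφ2 p hp).symm) measurableSet_strip
  have iψ2 : IntegrableOn (fun p => ψ p ^ 2) strip := by
    have h := integrableOn_mul_f_weight_eta hg hgs hgsub (c := fun p : ℝ × ℝ => Dz f p.1 p.2)
      hg.continuous.continuousOn
    refine h.congr_fun (fun p hp => ?_) measurableSet_strip
    rw [eψ2 p hp]; ring
  have iY := integrableOn_mul_Dθ_weight (α := α) hf2 hs hsub (c := fun p : ℝ × ℝ => Dθ f p.1 p.2) hDon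
  have hCS := sq_integral_mul_le iφ2 iψ2 iφψ
  set Y : ℝ := ∫ p in strip, (Dθ f p.1 p.2 * radialWeight p.1) ^ 2 * Real.sin (2 * p.2) ^ (-gammaExp α) with hY
  set Z : ℝ := ∫ p in strip, (Dz f p.1 p.2 * radialWeight p.1) ^ 2 * Real.sin (2 * p.2) ^ (-eta) with hZ
  have hφ2le : ∫ p in strip, φ p ^ 2 ≤ 9 / 16 * Y := by
    have eY : Y = ∫ p in strip, Dθ f p.1 p.2 * Dθ f p.1 p.2 * radialWeight p.1 ^ 2 *
        Real.sin (2 * p.2) ^ (-gammaExp α) :=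
      setIntegral_congr_fun measurableSet_strip fun p _ => by ring
    rw [eY, ← integral_const_mul]
    refine setIntegral_mono_on iφ2 (iY.const_mul _) measurableSet_strip fun p hp => ?_
    rw [eφ2 p hp]
    have hz : (0 : ℝ) < p.1 := hp.1
    have hsθ : 0 < Real.sin (2 * p.2) := Real.sin_pos_of_pos_of_lt_pi (by linarith [hp.2.1]) (by linarith [hp.2.2])
    have hq1 : 3 * p.1 / (1 + p.1) ^ 2 ≤ 3 / 4 := by
      rw [div_le_iff₀ (by positivity)]
      nlinarith [sq_nonneg (1 - p.1)]
    have hq0 : 0 ≤ 3 * p.1 / (1 + p.1) ^ 2 := by positivity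
    have hq2 : (3 * p.1 / (1 + p.1) ^ 2) ^ 2 ≤ 9 / 16 := by nlinarith
    have hρ : Real.sin (2 * p.2) ^ (-eta) ≤ Real.sin (2 * p.2) ^ (-gammaExp α) :=
      Real.rpow_le_rpow_of_exponent_ge hsθ (Real.sin_le_one _) (by unfold eta gammaExp; linarith)
    have hDD : 0 ≤ Dθ f p.1 p.2 * Dθ f p.1 p.2 * radialWeight p.1 ^ 2 := by
      have e : Dθ f p.1 p.2 * Dθ f p.1 p.2 * radialWeight p.1 ^ 2 = (Dθ f p.1 p.2 * radialWeight p.1) ^ 2 := by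
        ring
      rw [e]; exact sq_nonneg _
    have hrest : Dθ f p.1 p.2 * Dθ f p.1 p.2 * radialWeight p.1 ^ 2 * Real.sin (2 * p.2) ^ (-eta) ≤
        Dθ f p.1 p.2 * Dθ f p.1 p.2 * radialWeight p.1 ^ 2 * Real.sin (2 * p.2) ^ (-gammaExp α) :=
      mul_le_mul_of_nonneg_left hρ hDD
    have hrest0 : 0 ≤ Dθ f p.1 p.2 * Dθ f p.1 p.2 * radialWeight p.1 ^ 2 * Real.sin (2 * p.2) ^ (-eta) :=
      mul_nonneg hDD (Real.rpow_nonneg hsθ.le _)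
    calc (3 * p.1 / (1 + p.1) ^ 2) ^ 2 * Dθ f p.1 p.2 * Dθ f p.1 p.2 * radialWeight p.1 ^ 2 *
          Real.sin (2 * p.2) ^ (-eta)
        = (3 * p.1 / (1 + p.1) ^ 2) ^ 2 * (Dθ f p.1 p.2 * Dθ f p.1 p.2 * radialWeight p.1 ^ 2 *
            Real.sin (2 * p.2) ^ (-eta)) := by ring
      _ ≤ 9 / 16 * (Dθ f p.1 p.2 * Dθ f p.1 p.2 * radialWeight p.1 ^ 2 * Real.sin (2 * p.2) ^ (-eta)) :=
          mul_le_mul_of_nonneg_right hq2 hrest0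
      _ ≤ 9 / 16 * (Dθ f p.1 p.2 * Dθ f p.1 p.2 * radialWeight p.1 ^ 2 *
            Real.sin (2 * p.2) ^ (-gammaExp α)) := mul_le_mul_of_nonneg_left hrest (by norm_num)
  have hZ0 : 0 ≤ Z := by
    simp only [hZ]
    rw [← setIntegral_congr_fun measurableSet_strip eψ2]
    exact integral_nonneg fun p => sq_nonneg _
  have eT : ∫ p in strip, 3 * p.1 / (1 + p.1) ^ 2 * Dθ f p.1 p.2 * Dz f p.1 p.2 * radialWeight p.1 ^ 2 *
      Real.sin (2 * p.2) ^ (-eta) = ∫ p in strip, φ p * ψ p :=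
    (setIntegral_congr_fun measurableSet_strip eφψ).symm
  have eZ : ∫ p in strip, ψ p ^ 2 = Z := setIntegral_congr_fun measurableSet_strip eψ2
  rw [eT]
  rw [eZ] at hCS
  calc (∫ p in strip, φ p * ψ p) ^ 2 ≤ (∫ p in strip, φ p ^ 2) * Z := hCS
    _ ≤ (9 / 16 * Y) * Z := mul_le_mul_of_nonneg_right hφ2le hZ0
    _ = 9 / 16 * Y * Z := by ring

/-- **`I₇`'s profile pairing**: `J₇ = ∬(Γ/c)(2z²(2−z)/(1+z)⁴)·D_zf·w²sin^{−η}` has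
`J₇² ≤ 1309·∬(D_zf·w)²sin^{−η}` (`∫₀^∞(2−z)²/(1+z)⁴ = 1`, `∫Γ²sin^{−η} ≤ 100π`, `c ≥ 49/50`;
printed: "`|I₇w/√sin^η| ≤ (100/√(1−η))|fw|`", `I₇ = L₁₂((3/(1+z))D_θf)(0)·(Γ/c)(2z²(2−z)/(1+z)⁴)`). [cite: Elgindi2021, §6.2, proof of Proposition 6.9 (p. 17 of arXiv:1904.04795)] -/
theorem sq_J7_le (hα : 0 < α) (hα' : α ≤ 1 / 200) :
    (∫ p in strip, angularWeight α p.2 / profileConst α * (2 * p.1 ^ 2 * (2 - p.1) / (1 + p.1) ^ 4) *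
        Dz f p.1 p.2 * radialWeight p.1 ^ 2 * Real.sin (2 * p.2) ^ (-eta)) ^ 2 ≤
      1309 * ∫ p in strip, (Dz f p.1 p.2 * radialWeight p.1) ^ 2 * Real.sin (2 * p.2) ^ (-eta) := by
  have hg : ContDiff ℝ 2 (uncurry (Dz f)) := contDiff_Dz (n := 2) hf hsub
  have hgs : HasCompactSupport (uncurry (Dz f)) := hasCompactSupport_Dz hs
  have hgsub : tsupport (uncurry (Dz f)) ⊆ strip := tsupport_Dz_subset.trans hsub
  have hcpos : 0 < profileConst α := profileConst_pos hα.le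
  have hc49 : (49 / 50 : ℝ) ≤ profileConst α := profileConst_ge hα.le hα'
  have hΓc : Continuous (angularWeight α) := continuous_angularWeight hα.le
  set τ : ℝ → ℝ := fun θ => Real.sin (2 * θ) ^ (-eta / 2) with hτ
  set φ : ℝ × ℝ → ℝ := fun p => Dz f p.1 p.2 * radialWeight p.1 * τ p.2 with hφ
  set ψ : ℝ × ℝ → ℝ := fun p => 2 * (2 - p.1) / (profileConst α * (1 + p.1) ^ 2) * angularWeight α p.2 * τ p.2
    with hψ
  have hτ2 : ∀ p ∈ strip, τ p.2 ^ 2 = Real.sin (2 * p.2) ^ (-eta) := fun p hp =>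
    rpow_half_sq (Real.sin_pos_of_pos_of_lt_pi (by linarith [hp.2.1]) (by linarith [hp.2.2]))
  have eφψ : ∀ p ∈ strip, φ p * ψ p = angularWeight α p.2 / profileConst α *
      (2 * p.1 ^ 2 * (2 - p.1) / (1 + p.1) ^ 4) * Dz f p.1 p.2 * radialWeight p.1 ^ 2 *
      Real.sin (2 * p.2) ^ (-eta) := by
    intro p hp
    have hz : (0 : ℝ) < p.1 := hp.1
    rw [← hτ2 p hp]
    simp only [hφ, hψ]
    unfold radialWeight
    field_simp
  have eφ2 : ∀ p ∈ strip, φ p ^ 2 = (Dz f p.1 p.2 * radialWeight p.1) ^ 2 * Real.sin (2 * p.2) ^ (-eta) := by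
    intro p hp
    rw [← hτ2 p hp]
    simp only [hφ]
    ring
  have eψ2 : ∀ p ∈ strip, ψ p ^ 2 = (4 / profileConst α ^ 2 * ((2 - p.1) ^ 2 / (1 + p.1) ^ 4)) *
      (angularWeight α p.2 ^ 2 * Real.sin (2 * p.2) ^ (-eta)) := by
    intro p hp
    have hz : (0 : ℝ) < p.1 := hp.1
    rw [← hτ2 p hp]
    simp only [hψ]
    field_simp
    ring
  have hPon : ContinuousOn (fun p : ℝ × ℝ => angularWeight α p.2 / profileConst α *
      (2 * p.1 ^ 2 * (2 - p.1) / (1 + p.1) ^ 4)) strip := by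
    refine ((hΓc.comp continuous_snd).continuousOn.div_const _).mul ?_
    exact ContinuousOn.div (by fun_prop) (by fun_prop) fun p hp => by
      have : (0 : ℝ) < p.1 := hp.1; positivity
  have iφψ : IntegrableOn (fun p => φ p * ψ p) strip :=
    (integrableOn_mul_f_weight_eta hg hgs hgsub hPon).congr_fun (fun p hp => (eφψ p hp).symm) measurableSet_strip
  have iφ2 : IntegrableOn (fun p => φ p ^ 2) strip := by
    have h := integrableOn_mul_f_weight_eta hg hgs hgsub (c := fun p : ℝ × ℝ => Dz f p.1 p.2)
      hg.continuous.continuousOn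
    refine h.congr_fun (fun p hp => ?_) measurableSet_strip
    rw [eφ2 p hp]; ring
  have iz : Integrable (fun z : ℝ => 4 / profileConst α ^ 2 * ((2 - z) ^ 2 / (1 + z) ^ 4)) (volume.restrict (Ioi 0)) :=
    (integrableOn_sq_two_sub_div_pow_four.const_mul _)
  have iθ : Integrable (fun θ : ℝ => angularWeight α θ ^ 2 * Real.sin (2 * θ) ^ (-eta))
      (volume.restrict (Ioo 0 (π / 2))) := integrableOn_angularWeight_sq_mul_rpow_eta hα.le
  have iψ2 : IntegrableOn (fun p => ψ p ^ 2) strip := by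
    have h := iz.mul_prod iθ
    rw [← volume_restrict_strip] at h
    exact IntegrableOn.congr_fun h (fun p hp => (eψ2 p hp).symm) measurableSet_strip
  have hCS := sq_integral_mul_le iφ2 iψ2 iφψ
  have hψ2 : ∫ p in strip, ψ p ^ 2 = (4 / profileConst α ^ 2 * ∫ z in Ioi (0 : ℝ), (2 - z) ^ 2 / (1 + z) ^ 4) *
      ∫ θ in Ioo 0 (π / 2), angularWeight α θ ^ 2 * Real.sin (2 * θ) ^ (-eta) := by
    rw [setIntegral_congr_fun measurableSet_strip eψ2, volume_restrict_strip,
      integral_prod_mul (f := fun z : ℝ => 4 / profileConst α ^ 2 * ((2 - z) ^ 2 / (1 + z) ^ 4))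
        (g := fun θ : ℝ => angularWeight α θ ^ 2 * Real.sin (2 * θ) ^ (-eta)), integral_const_mul]
  rw [integral_Ioi_sq_two_sub_div_pow_four, mul_one] at hψ2
  have hAng := integral_angularWeight_sq_mul_rpow_eta_le hα.le
  set Z : ℝ := ∫ p in strip, (Dz f p.1 p.2 * radialWeight p.1) ^ 2 * Real.sin (2 * p.2) ^ (-eta) with hZ
  have hZ0 : 0 ≤ Z := by
    simp only [hZ]
    rw [← setIntegral_congr_fun measurableSet_strip eφ2]
    exact integral_nonneg fun p => sq_nonneg _
  have hAng0 : 0 ≤ ∫ θ in Ioo 0 (π / 2), angularWeight α θ ^ 2 * Real.sin (2 * θ) ^ (-eta) := by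
    refine setIntegral_nonneg measurableSet_Ioo fun θ hθ => ?_
    have hsθ : 0 < Real.sin (2 * θ) := Real.sin_pos_of_pos_of_lt_pi (by linarith [hθ.1]) (by linarith [hθ.2])
    exact mul_nonneg (sq_nonneg _) (Real.rpow_nonneg hsθ.le _)
  have eT : ∫ p in strip, angularWeight α p.2 / profileConst α * (2 * p.1 ^ 2 * (2 - p.1) / (1 + p.1) ^ 4) *
      Dz f p.1 p.2 * radialWeight p.1 ^ 2 * Real.sin (2 * p.2) ^ (-eta) = ∫ p in strip, φ p * ψ p :=
    (setIntegral_congr_fun measurableSet_strip eφψ).symm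
  have eZ : ∫ p in strip, φ p ^ 2 = Z := setIntegral_congr_fun measurableSet_strip eφ2
  rw [eT]
  rw [eZ, hψ2] at hCS
  have hc2 : 4 / profileConst α ^ 2 ≤ 4 / (49 / 50 : ℝ) ^ 2 := by
    apply div_le_div_of_nonneg_left (by norm_num) (by norm_num)
    exact pow_le_pow_left₀ (by norm_num) hc49 2
  have hπ := Real.pi_lt_d4
  have hψ2le : 4 / profileConst α ^ 2 * ∫ θ in Ioo 0 (π / 2), angularWeight α θ ^ 2 *
      Real.sin (2 * θ) ^ (-eta) ≤ 1309 := by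
    calc 4 / profileConst α ^ 2 * ∫ θ in Ioo 0 (π / 2), angularWeight α θ ^ 2 * Real.sin (2 * θ) ^ (-eta)
        ≤ 4 / (49 / 50 : ℝ) ^ 2 * (100 * π) := mul_le_mul hc2 hAng hAng0 (by norm_num)
      _ ≤ 1309 := by nlinarith [hπ]
  calc (∫ p in strip, φ p * ψ p) ^ 2 ≤ Z * (4 / profileConst α ^ 2 *
        ∫ θ in Ioo 0 (π / 2), angularWeight α θ ^ 2 * Real.sin (2 * θ) ^ (-eta)) := hCS
    _ ≤ Z * 1309 := mul_le_mul_of_nonneg_left hψ2le hZ0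
    _ = 1309 * Z := by ring

/-- **The splitting of the `D_z`-pairing** along `D_z𝓛_Γ^T(f) = Σ_{i=1}^7 I_i`:
`∬D_z𝓛_Γ^T(f)·D_zf·w²sin^{−η} = E₁ + E₂ + E₃ − E₄ + E₅ − E₆ + ℓ₀J₇`. [folklore] -/
theorem integral_Dz_opLΓT_pairing_eq (hα : 0 ≤ α) :
    ∫ p in strip, Dz (opLΓT α f) p.1 p.2 * Dz f p.1 p.2 * radialWeight p.1 ^ 2 * Real.sin (2 * p.2) ^ (-eta) =
      (∫ p in strip, opL (Dz f) p.1 p.2 * Dz f p.1 p.2 * radialWeight p.1 ^ 2 * Real.sin (2 * p.2) ^ (-eta))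
      + (∫ p in strip, 2 * p.1 / (1 + p.1) ^ 2 * f p.1 p.2 * Dz f p.1 p.2 * radialWeight p.1 ^ 2 *
          Real.sin (2 * p.2) ^ (-eta))
      + (∫ p in strip, 2 * p.1 * angularWeight α p.2 / (profileConst α * (1 + p.1) ^ 2) * kMoment f p.1 *
          Dz f p.1 p.2 * radialWeight p.1 ^ 2 * Real.sin (2 * p.2) ^ (-eta))
      - (∫ p in strip, 2 * p.1 * (1 - p.1) * angularWeight α p.2 / (profileConst α * (1 + p.1) ^ 3) *
          L12 f p.1 * Dz f p.1 p.2 * radialWeight p.1 ^ 2 * Real.sin (2 * p.2) ^ (-eta))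
      + (∫ p in strip, 3 * p.1 / (1 + p.1) ^ 2 * Dθ f p.1 p.2 * Dz f p.1 p.2 * radialWeight p.1 ^ 2 *
          Real.sin (2 * p.2) ^ (-eta))
      - (∫ p in strip, 3 / (1 + p.1) * Dθ (Dz f) p.1 p.2 * Dz f p.1 p.2 * radialWeight p.1 ^ 2 *
          Real.sin (2 * p.2) ^ (-eta))
      + L12 (fun z θ => 3 / (1 + z) * Dθ f z θ) 0 *
        ∫ p in strip, angularWeight α p.2 / profileConst α * (2 * p.1 ^ 2 * (2 - p.1) / (1 + p.1) ^ 4) *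
          Dz f p.1 p.2 * radialWeight p.1 ^ 2 * Real.sin (2 * p.2) ^ (-eta) := by
  have hf2 : ContDiff ℝ 2 (uncurry f) := hf.of_le (by norm_num)
  have hf1 : ContDiff ℝ 1 (uncurry f) := hf.of_le (by norm_num)
  have hg : ContDiff ℝ 2 (uncurry (Dz f)) := contDiff_Dz (n := 2) hf hsub
  have hgs : HasCompactSupport (uncurry (Dz f)) := hasCompactSupport_Dz hs
  have hgsub : tsupport (uncurry (Dz f)) ⊆ strip := tsupport_Dz_subset.trans hsub
  have hcpos : 0 < profileConst α := profileConst_pos hα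
  have hΓc : Continuous (angularWeight α) := continuous_angularWeight hα
  have hfon : ContinuousOn (fun p : ℝ × ℝ => f p.1 p.2) strip := hf.continuous.continuousOn
  have hgon : ContinuousOn (fun p : ℝ × ℝ => Dz f p.1 p.2) strip := hg.continuous.continuousOn
  have hLc : Continuous (L12 f) := continuous_L12 hf.continuous hs hsub
  have hKc : Continuous (kMoment f) := continuous_kMoment hf.continuous
  have hDon : ContinuousOn (fun p : ℝ × ℝ => Dθ f p.1 p.2) strip := (continuous_Dθ hf1).continuousOn
  have hDgon : ContinuousOn (fun p : ℝ × ℝ => Dθ (Dz f) p.1 p.2) strip :=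
    (continuous_Dθ (hg.of_le (by norm_num))).continuousOn
  have c1 : ContinuousOn (fun p : ℝ × ℝ => opL (Dz f) p.1 p.2) strip := by
    have hdz : ContinuousOn (fun p : ℝ × ℝ => Dz (Dz f) p.1 p.2) strip :=
      (continuous_fst.mul (continuous_dz (hg.of_le (by norm_num)))).continuousOn
    have h3 : ContinuousOn (fun p : ℝ × ℝ => 2 * Dz f p.1 p.2 / (1 + p.1)) strip :=
      (continuousOn_const.mul hgon).div (by fun_prop) fun p hp => by
        have : (0 : ℝ) < p.1 := hp.1; positivity
    exact ((hgon.add hdz).sub h3).congr fun p _ => by simp only [Pi.add_apply, Pi.sub_apply, opL_apply]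
  have c2 : ContinuousOn (fun p : ℝ × ℝ => 2 * p.1 / (1 + p.1) ^ 2 * f p.1 p.2) strip :=
    (ContinuousOn.div (by fun_prop) (by fun_prop) fun p hp => by
      have : (0 : ℝ) < p.1 := hp.1; positivity).mul hfon
  have c3 : ContinuousOn (fun p : ℝ × ℝ => 2 * p.1 * angularWeight α p.2 /
      (profileConst α * (1 + p.1) ^ 2) * kMoment f p.1) strip := by
    refine (ContinuousOn.div (by exact ((continuous_const.mul continuous_fst).mul
      (hΓc.comp continuous_snd)).continuousOn) (by fun_prop) fun p hp => ?_).mul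
      (hKc.comp continuous_fst).continuousOn
    have : (0 : ℝ) < p.1 := hp.1
    exact mul_ne_zero hcpos.ne' (by positivity)
  have c4 : ContinuousOn (fun p : ℝ × ℝ => 2 * p.1 * (1 - p.1) * angularWeight α p.2 /
      (profileConst α * (1 + p.1) ^ 3) * L12 f p.1) strip := by
    refine (ContinuousOn.div (by exact (((continuous_const.mul continuous_fst).mul
      (continuous_const.sub continuous_fst)).mul (hΓc.comp continuous_snd)).continuousOn)
      (by fun_prop) fun p hp => ?_).mul (hLc.comp continuous_fst).continuousOn
    have : (0 : ℝ) < p.1 := hp.1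
    exact mul_ne_zero hcpos.ne' (by positivity)
  have c5 : ContinuousOn (fun p : ℝ × ℝ => 3 * p.1 / (1 + p.1) ^ 2 * Dθ f p.1 p.2) strip :=
    (ContinuousOn.div (by fun_prop) (by fun_prop) fun p hp => by
      have : (0 : ℝ) < p.1 := hp.1; positivity).mul hDon
  have c6 : ContinuousOn (fun p : ℝ × ℝ => 3 / (1 + p.1) * Dθ (Dz f) p.1 p.2) strip := by
    refine (ContinuousOn.div continuousOn_const (by fun_prop) fun p hp => ?_).mul hDgon
    have : (0 : ℝ) < p.1 := hp.1; positivity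
  have c7 : ContinuousOn (fun p : ℝ × ℝ => angularWeight α p.2 / profileConst α *
      (2 * p.1 ^ 2 * (2 - p.1) / (1 + p.1) ^ 4)) strip := by
    refine ((hΓc.comp continuous_snd).continuousOn.div_const _).mul ?_
    exact ContinuousOn.div (by fun_prop) (by fun_prop) fun p hp => by
      have : (0 : ℝ) < p.1 := hp.1; positivity
  have i1 := integrableOn_mul_f_weight_eta hg hgs hgsub c1
  have i2 := integrableOn_mul_f_weight_eta hg hgs hgsub c2
  have i3 := integrableOn_mul_f_weight_eta hg hgs hgsub c3
  have i4 := integrableOn_mul_f_weight_eta hg hgs hgsub c4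
  have i5 := integrableOn_mul_f_weight_eta hg hgs hgsub c5
  have i6 := integrableOn_mul_f_weight_eta hg hgs hgsub c6
  have i7 := integrableOn_mul_f_weight_eta hg hgs hgsub c7
  have hsplit : ∀ p ∈ strip, Dz (opLΓT α f) p.1 p.2 * Dz f p.1 p.2 * radialWeight p.1 ^ 2 *
      Real.sin (2 * p.2) ^ (-eta) =
      opL (Dz f) p.1 p.2 * Dz f p.1 p.2 * radialWeight p.1 ^ 2 * Real.sin (2 * p.2) ^ (-eta)
      + 2 * p.1 / (1 + p.1) ^ 2 * f p.1 p.2 * Dz f p.1 p.2 * radialWeight p.1 ^ 2 * Real.sin (2 * p.2) ^ (-eta)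
      + 2 * p.1 * angularWeight α p.2 / (profileConst α * (1 + p.1) ^ 2) * kMoment f p.1 *
          Dz f p.1 p.2 * radialWeight p.1 ^ 2 * Real.sin (2 * p.2) ^ (-eta)
      - 2 * p.1 * (1 - p.1) * angularWeight α p.2 / (profileConst α * (1 + p.1) ^ 3) *
          L12 f p.1 * Dz f p.1 p.2 * radialWeight p.1 ^ 2 * Real.sin (2 * p.2) ^ (-eta)
      + 3 * p.1 / (1 + p.1) ^ 2 * Dθ f p.1 p.2 * Dz f p.1 p.2 * radialWeight p.1 ^ 2 * Real.sin (2 * p.2) ^ (-eta)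
      - 3 / (1 + p.1) * Dθ (Dz f) p.1 p.2 * Dz f p.1 p.2 * radialWeight p.1 ^ 2 * Real.sin (2 * p.2) ^ (-eta)
      + L12 (fun z θ => 3 / (1 + z) * Dθ f z θ) 0 *
          (angularWeight α p.2 / profileConst α * (2 * p.1 ^ 2 * (2 - p.1) / (1 + p.1) ^ 4) *
            Dz f p.1 p.2 * radialWeight p.1 ^ 2 * Real.sin (2 * p.2) ^ (-eta)) := by
    intro p hp
    rw [Dz_opLΓT hα hf2 hs hsub hp]
    ring
  rw [setIntegral_congr_fun measurableSet_strip hsplit, integral_add, integral_sub, integral_add,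
    integral_sub, integral_add, integral_add, integral_const_mul]
  all_goals first
    | exact i1
    | exact i2
    | exact i3
    | exact i4
    | exact i5
    | exact i6
    | exact i1.add i2
    | exact (i1.add i2).add i3
    | exact ((i1.add i2).add i3).sub i4
    | exact (((i1.add i2).add i3).sub i4).add i5
    | exact ((((i1.add i2).add i3).sub i4).add i5).sub i6
    | exact (i7.const_mul _)

end Prop69

/-! ### Proposition 6.9 -/

/-- **`L²` coercivity of `𝓛_Γ^T` with one `z`-derivative** (Elgindi 2021, Proposition 6.9:
"Under the assumptions of Corollary 6.8, we have `((D_z𝓛_Γ^T(f)), (D_zf)w²/sin(2θ)^η)_{L²} ≥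
¼|(D_zf)w/√(sin(2θ)^η)|²_{L²} − 10⁸E_θ¹`", `E_θ¹ = |(D_θf)w/√(sin(2θ)^γ)|² + |fw/√(sin(2θ)^η)|²`),
for `0 < α ≤ 1/200` and `f ∈ C³` compactly supported inside the open strip with `L₁₂(f)(0) = 0`:
`¼∬(D_zf·w)²sin^{−η} − 10⁸(∬(D_θf·w)²sin^{−γ} + ∬(fw)²sin^{−η}) ≤ ∬D_z𝓛_Γ^T(f)·D_zf·w²sin^{−η}`. [cite: Elgindi2021, §6.2 Proposition 6.9 (p. 17 of arXiv:1904.04795)] -/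
theorem radialDerivativeCoercivity {α : ℝ} (hα : 0 < α) (hα' : α ≤ 1 / 200) {f : ℝ → ℝ → ℝ}
    (hf : ContDiff ℝ 3 (uncurry f)) (hs : HasCompactSupport (uncurry f))
    (hsub : tsupport (uncurry f) ⊆ strip) (hL0 : L12 f 0 = 0) :
    1 / 4 * (∫ p in strip, (Dz f p.1 p.2 * radialWeight p.1) ^ 2 * Real.sin (2 * p.2) ^ (-eta)) -
        10 ^ 8 * ((∫ p in strip, (Dθ f p.1 p.2 * radialWeight p.1) ^ 2 * Real.sin (2 * p.2) ^ (-gammaExp α)) +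
          ∫ p in strip, (f p.1 p.2 * radialWeight p.1) ^ 2 * Real.sin (2 * p.2) ^ (-eta)) ≤
      ∫ p in strip, Dz (opLΓT α f) p.1 p.2 * Dz f p.1 p.2 * radialWeight p.1 ^ 2 *
        Real.sin (2 * p.2) ^ (-eta) := by
  have hf2 : ContDiff ℝ 2 (uncurry f) := hf.of_le (by norm_num)
  have hg : ContDiff ℝ 2 (uncurry (Dz f)) := contDiff_Dz (n := 2) hf hsub
  have hgs : HasCompactSupport (uncurry (Dz f)) := hasCompactSupport_Dz hs
  have hgsub : tsupport (uncurry (Dz f)) ⊆ strip := tsupport_Dz_subset.trans hsub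
  rw [integral_Dz_opLΓT_pairing_eq hf hs hsub hα.le]
  set X : ℝ := ∫ p in strip, (f p.1 p.2 * radialWeight p.1) ^ 2 * Real.sin (2 * p.2) ^ (-eta) with hX
  set Y : ℝ := ∫ p in strip, (Dθ f p.1 p.2 * radialWeight p.1) ^ 2 * Real.sin (2 * p.2) ^ (-gammaExp α) with hY
  set Z : ℝ := ∫ p in strip, (Dz f p.1 p.2 * radialWeight p.1) ^ 2 * Real.sin (2 * p.2) ^ (-eta) with hZ
  set A : ℝ := ∫ p in strip, (f p.1 p.2 * radialWeight p.1) ^ 2 with hA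
  set E1 : ℝ := ∫ p in strip, opL (Dz f) p.1 p.2 * Dz f p.1 p.2 * radialWeight p.1 ^ 2 *
    Real.sin (2 * p.2) ^ (-eta) with hE1
  set E2 : ℝ := ∫ p in strip, 2 * p.1 / (1 + p.1) ^ 2 * f p.1 p.2 * Dz f p.1 p.2 * radialWeight p.1 ^ 2 *
    Real.sin (2 * p.2) ^ (-eta) with hE2
  set E3 : ℝ := ∫ p in strip, 2 * p.1 * angularWeight α p.2 / (profileConst α * (1 + p.1) ^ 2) * kMoment f p.1 *
    Dz f p.1 p.2 * radialWeight p.1 ^ 2 * Real.sin (2 * p.2) ^ (-eta) with hE3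
  set E4 : ℝ := ∫ p in strip, 2 * p.1 * (1 - p.1) * angularWeight α p.2 / (profileConst α * (1 + p.1) ^ 3) *
    L12 f p.1 * Dz f p.1 p.2 * radialWeight p.1 ^ 2 * Real.sin (2 * p.2) ^ (-eta) with hE4
  set E5 : ℝ := ∫ p in strip, 3 * p.1 / (1 + p.1) ^ 2 * Dθ f p.1 p.2 * Dz f p.1 p.2 * radialWeight p.1 ^ 2 *
    Real.sin (2 * p.2) ^ (-eta) with hE5
  set E6 : ℝ := ∫ p in strip, 3 / (1 + p.1) * Dθ (Dz f) p.1 p.2 * Dz f p.1 p.2 * radialWeight p.1 ^ 2 *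
    Real.sin (2 * p.2) ^ (-eta) with hE6
  set ℓ₀ : ℝ := L12 (fun z θ => 3 / (1 + z) * Dθ f z θ) 0 with hℓ₀
  set J : ℝ := ∫ p in strip, angularWeight α p.2 / profileConst α * (2 * p.1 ^ 2 * (2 - p.1) / (1 + p.1) ^ 4) *
    Dz f p.1 p.2 * radialWeight p.1 ^ 2 * Real.sin (2 * p.2) ^ (-eta) with hJ
  have h1 : E1 = (1 / 2) * Z :=
    integral_strip_opL_energy_weight (hg.of_le (by norm_num)) hgs hgsub (contDiffOn_sin_two_mul_rpow _)
  have h2 : E2 ^ 2 ≤ 1 / 4 * X * Z := sq_I2_le hf hs hsub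
  have h3 : E3 ^ 2 ≤ 1157 * A * Z := sq_I3_le hf hs hsub hα hα'
  have h4 : E4 ^ 2 ≤ 4625 * A * Z := sq_I4_le hf hs hsub hα hα' hL0
  have h5 : E5 ^ 2 ≤ 9 / 16 * Y * Z := sq_I5_le hf hs hsub hα.le
  have h6 : -(3 / 100) * Z ≤ -E6 := integral_transport_eta_ge hg hgs hgsub
  have h7a : J ^ 2 ≤ 1309 * Z := sq_J7_le hf hs hsub hα hα'
  have h7b : ℓ₀ ^ 2 ≤ 153 * A := sq_L12_transport_le_sq_norm hf2 hs hsub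
  have hAX : A ≤ X := integral_sq_le_weighted_eta hf2 hs hsub
  have hA0 : 0 ≤ A := integral_nonneg fun p => sq_nonneg _
  have hX0 : 0 ≤ X := hA0.trans hAX
  have hY0 : 0 ≤ Y := by
    simp only [hY]
    refine setIntegral_nonneg measurableSet_strip fun p hp => ?_
    have hsθ : 0 < Real.sin (2 * p.2) := Real.sin_pos_of_pos_of_lt_pi (by linarith [hp.2.1]) (by linarith [hp.2.2])
    exact mul_nonneg (sq_nonneg _) (Real.rpow_nonneg hsθ.le _)
  have hZ0 : 0 ≤ Z := by
    simp only [hZ]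
    refine setIntegral_nonneg measurableSet_strip fun p hp => ?_
    have hsθ : 0 < Real.sin (2 * p.2) := Real.sin_pos_of_pos_of_lt_pi (by linarith [hp.2.1]) (by linarith [hp.2.2])
    exact mul_nonneg (sq_nonneg _) (Real.rpow_nonneg hsθ.le _)
  have h7 : (ℓ₀ * J) ^ 2 ≤ (153 * 1309) * A * Z := by
    rw [mul_pow]
    calc ℓ₀ ^ 2 * J ^ 2 ≤ (153 * A) * (1309 * Z) := mul_le_mul h7b h7a (sq_nonneg _) (by positivity)
      _ = (153 * 1309) * A * Z := by ring
  have hδ : (0 : ℝ) < 1 / 25 := by norm_num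
  have b2 := abs_le.1 (abs_le_of_sq_le_mul (by norm_num) hX0 hZ0 hδ h2)
  have b3 := abs_le.1 (abs_le_of_sq_le_mul (by norm_num) hA0 hZ0 hδ h3)
  have b4 := abs_le.1 (abs_le_of_sq_le_mul (by norm_num) hA0 hZ0 hδ h4)
  have b5 := abs_le.1 (abs_le_of_sq_le_mul (by norm_num) hY0 hZ0 hδ h5)
  have b7 := abs_le.1 (abs_le_of_sq_le_mul (by norm_num) hA0 hZ0 hδ h7)
  nlinarith [b2.1, b2.2, b3.1, b3.2, b4.1, b4.2, b5.1, b5.2, b7.1, b7.2, h1, h6, hAX, hA0, hX0, hY0, hZ0]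

end Elgindi

end Literature.Analysis.FluidPDE
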